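import Summits.BirchSwinnertonDyer.BirchSwinnertonDyer.Theorems.SignedLowerHalvesSprungLowerHalfAtThreeSelmerNineShape
import Summits.BirchSwinnertonDyer.Rank1Residual.Supersingular.RankZeroSurjThreeCertificates_01
import Summits.BirchSwinnertonDyer.Rank1Residual.Supersingular.RankZeroSurjThreeCertificates_02
import HarnessLib

/-!
# Route `SignedLowerHalves`, crux `SprungLowerHalfAtThree` (item stmt-BirchSwinnertonDyer-19003), its LEAF
# BRANCH `r_an = 0 ∧ surj(3)` PER PAIR — RECORDS part B of 4: `BSD(E,3)` for `9251d1`, `9266f1`, `9718c1`, `9878f1`, `9950f1`, `10550f1`, `11075f1`, `11123a1`, `12145b1`, `12155c1`, `12584l1`, `13736e1`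
# from PUBLISHED facts + the landed two-engine `3`-descent rows (cell `bsd-ssimc`, seat `bsd-ssimc-k3-c5`
# gen 5; a `--supports … --as helper` file; closes nothing about the crux)

PARTITION (cell bsd-ssimc): X8 (A8) × 12 of the 49 window cells `r_an = 0 ∧ surj(3) ∧ ord₃ #Ш_an = 2`
(all 49 have `N < 2·10⁴`; 48 of them carried ONLY the K25-conditional offer `bsdp_x8r0kp3_*` before, and
`11123a1` — crux 5's BC5 «first value» pair — carried no `BSDp` theorem at all) — closes PER PAIR (OFFERS;
the desk books, nothing is booked here); types nothing new; crux 5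
(`Summit.BirchSwinnertonDyer.BirchSwinnertonDyer.Theses.SignedLowerHalves.SprungLowerHalfAtThree`) stays OPEN
(clause (A) = modularity, `…Characterization.lean`). HONEST FRAMING: BSD is not proved by any of this;
nothing here is new mathematics — the road is cell `b2b-bsdres`'s (consumer
`Supersingular.X8.bsdp_rankZero_of_casselsTate_of_selmerGroup_ne_bot_of_surj`, `DescentLowerBound.lean`;
rows `Supersingular/X8DescentRecords.lean`, x10b gen 5, kit j091546: engine 1 = x11b `desc3lib.gp` EXACT-3,
engine 2 = `desc3full_e2.py`, `dim_𝔽₃ Sel^(3)(E/ℚ) = 2` on both, same `𝔽₃`-subspace of `A^×/A^{×3}`);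
this seat only types the per-pair theorems that were never written off those rows. THEOREMS ONLY (no
definition, no named fact, no `sorry`).

Each record instantiates `X8.bsdp_three_rankZero_of_ainvs_of_selmerGroup_ne_bot_of_surj` (`…SelmerNineShape.lean`)
on the literal Cremona model: global minimality (bounded Kraus criterion), `3 ∤ Δ` and `#Ẽ(𝔽₃) ∈ {1, 7}`
are DECIDED by the kernel; `ρ̄_{E,3}` onto is the landed certificate `surj_x8r0_<label>_3`
(`RankZeroSurjThreeCertificates_0*`). What REMAINS displayed: the PUBLISHED named facts `hCT`
(Cassels–Tate), `hW` (Wuthrich 2014 Prop. 21), `hGZK`, `hmod`; per pair `hr` (`r_an = 0`, Cremona),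
`hq`/`hv` (`#Ш_an = q`, `ord₃ q ≤ 2`; here `#Ш_an = 9`), and the certificate line `hSel : Sel^(3)(E/ℚ) ≠ ⊥`
whose EVIDENCE is the landed row named in each docstring (`checked_x8_rankZero_sha9_desc3_k`, cert sha256
prefix) — the same tier as the tree's other flag-free per-pair A8 theorems (`bsdp3_b1n_*`, `bsdp3_nn*`).
Mathematics of the chain (all PROVED in the tree below the named facts): `r = 0` (GZK) and `E(ℚ)[3] = 0`
(`E[3]` irreducible on X8) make `Sel^(3)(E/ℚ) ↪ Ш[3]`, so `Ш[3] ≠ 0`, `3 ∣ #Ш`, `9 ∣ #Ш` (Cassels–Tate) =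
`ord₃ #Ш_an ≤ ord₃ #Ш`; Wuthrich's Prop. 21 (image onto) gives `≥`.

References: [Wuthrich2014] Prop. 21; [SilvermanAEC2009] Thm. X.4.14, VII.1 Rem. 1.1, VII.5 Prop. 5.1(a);
[Serre1972] §1.11 Prop. 12, §2.4 Prop. 15; [Miller2011LMS] Def. 1.1; [Cremona2006] Table 1; Schaefer–Stoll,
Trans. AMS 356 (2004) (the descent engines' method).
-/

set_option autoImplicit false
set_option linter.dupNamespace false

noncomputable section

open scoped Classical

open WeierstrassCurve Literature.NumberTheory.EllipticCurves
  Literature.NumberTheory.EllipticCurves.Rank1Residual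
  Literature.NumberTheory.EllipticCurves.Rank1Residual.Typed
  Literature.NumberTheory.EllipticCurves.Rank1Residual.X11RankOneCertificates
  Literature.NumberTheory.EllipticCurves.Wuthrich2014
  Summit.BirchSwinnertonDyer.BirchSwinnertonDyer.Rank1Residual.X11RankOne
  Summit.BirchSwinnertonDyer.Rank1Residual.Supersingular

namespace Summit.BirchSwinnertonDyer.BirchSwinnertonDyer.Theorems

/-- **`BSD(E,3)` for `9251d1`** — X8 ∩ {r_an = 0} ∩ {surj(3)}, `#Ш_an = 9`; Cremona model `[0,0,1,-31117,-2115746]`,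
`N = 9251 = 11·29²`, good supersingular at `3` with `a₃ = 3`, `ρ̄_{E,3}` onto (`surj_x8r0_9251d1_3`), `#E(ℚ)_tors = 1`,
`∏ c_ℓ = 2`. Kernel-decided: global minimality (the bounded Kraus certificate of `surj_x8r0_9251d1_3`, verbatim), `3 ∤ Δ`, `#Ẽ(𝔽₃) = 1`. Binders: PUBLISHED `hCT`,
`hW`, `hGZK`, `hmod`; per pair `hr`, `hq`/`hv` (`#Ш_an = 9`), `hSel : Sel^(3)(E/ℚ) ≠ ⊥` — EVIDENCE: the landed
two-engine exact `3`-descent row of `9251d1` in `Supersingular/X8DescentRecords.lean` (`checked_x8_rankZero_sha9_desc3_2`;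
`dim_𝔽₃ Sel^(3) = 2` on both engines, same subspace; cert `06e10cdf79fc…`; kit j091546). Per pair; OFFER (the
desk books); class X8 and crux 5 unchanged. [cite: Wuthrich2014, Prop. 21 (p. 400)]
[cite: SilvermanAEC2009, Thm. X.4.14 and VII.1 Remark 1.1] [cite: Miller2011LMS, §1 and Def. 1.1]
[cite: Cremona2006, Table 1 (Cremona label 9251d1)] -/
theorem X8.bsdp3_sel9_9251d1 (hCT : exists_casselsTate_pairing (K := ℚ)) (hW : sha_dvd_analyticSha)
    (hGZK : rank_eq_analyticRank_of_analyticRank_le_one) (hmod : hasEntireLFunction_rat)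
    (W : WeierstrassCurve ℚ) (hWm : W = ⟨0, 0, 1, -31117, -2115746⟩) (hr : W.analyticRank = 0)
    {q : ℚ} (hq : shaAn W = (q : ℂ)) (hv : padicValRat 3 q ≤ 2) (hSel : W.selmerGroup (3 : ℤ) ≠ ⊥) :
    BSDp W 3 := by
  subst hWm
  exact X8.bsdp_three_rankZero_of_ainvs_of_selmerGroup_ne_bot_of_surj hCT hW hGZK hmod
    0 0 1 (-31117) (-2115746)
    (isGloballyMinimal_of_krausCriterion_bounded 0 0 1 (-31117) (-2115746)
      (by decide +kernel) (by decide +kernel) (by decide +kernel))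
    (by decide) (n₃ := 1) (by decide +kernel) (by decide) surj_x8r0_9251d1_3 hr hq hv hSel

/-- **`BSD(E,3)` for `9266f1`** — X8 ∩ {r_an = 0} ∩ {surj(3)}, `#Ш_an = 9`; Cremona model `[1,-1,0,-1696,-26464]`,
`N = 9266 = 2·41·113`, good supersingular at `3` with `a₃ = 3`, `ρ̄_{E,3}` onto (`surj_x8r0_9266f1_3`), `#E(ℚ)_tors = 1`,
`∏ c_ℓ = 1`. Kernel-decided: global minimality (the bounded Kraus certificate of `surj_x8r0_9266f1_3`, verbatim), `3 ∤ Δ`, `#Ẽ(𝔽₃) = 1`. Binders: PUBLISHED `hCT`,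
`hW`, `hGZK`, `hmod`; per pair `hr`, `hq`/`hv` (`#Ш_an = 9`), `hSel : Sel^(3)(E/ℚ) ≠ ⊥` — EVIDENCE: the landed
two-engine exact `3`-descent row of `9266f1` in `Supersingular/X8DescentRecords.lean` (`checked_x8_rankZero_sha9_desc3_2`;
`dim_𝔽₃ Sel^(3) = 2` on both engines, same subspace; cert `cd488823b4a9…`; kit j091546). Per pair; OFFER (the
desk books); class X8 and crux 5 unchanged. [cite: Wuthrich2014, Prop. 21 (p. 400)]
[cite: SilvermanAEC2009, Thm. X.4.14 and VII.1 Remark 1.1] [cite: Miller2011LMS, §1 and Def. 1.1]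
[cite: Cremona2006, Table 1 (Cremona label 9266f1)] -/
theorem X8.bsdp3_sel9_9266f1 (hCT : exists_casselsTate_pairing (K := ℚ)) (hW : sha_dvd_analyticSha)
    (hGZK : rank_eq_analyticRank_of_analyticRank_le_one) (hmod : hasEntireLFunction_rat)
    (W : WeierstrassCurve ℚ) (hWm : W = ⟨1, -1, 0, -1696, -26464⟩) (hr : W.analyticRank = 0)
    {q : ℚ} (hq : shaAn W = (q : ℂ)) (hv : padicValRat 3 q ≤ 2) (hSel : W.selmerGroup (3 : ℤ) ≠ ⊥) :
    BSDp W 3 := by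
  subst hWm
  exact X8.bsdp_three_rankZero_of_ainvs_of_selmerGroup_ne_bot_of_surj hCT hW hGZK hmod
    1 (-1) 0 (-1696) (-26464)
    (isGloballyMinimal_of_krausCriterion_bounded 1 (-1) 0 (-1696) (-26464)
      (by decide +kernel) (by decide +kernel) (by decide +kernel))
    (by decide) (n₃ := 1) (by decide +kernel) (by decide) surj_x8r0_9266f1_3 hr hq hv hSel

/-- **`BSD(E,3)` for `9718c1`** — X8 ∩ {r_an = 0} ∩ {surj(3)}, `#Ш_an = 9`; Cremona model `[1,-1,1,18,-12407]`,
`N = 9718 = 2·43·113`, good supersingular at `3` with `a₃ = 3`, `ρ̄_{E,3}` onto (`surj_x8r0_9718c1_3`), `#E(ℚ)_tors = 1`,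
`∏ c_ℓ = 2`. Kernel-decided: global minimality (the bounded Kraus certificate of `surj_x8r0_9718c1_3`, verbatim), `3 ∤ Δ`, `#Ẽ(𝔽₃) = 1`. Binders: PUBLISHED `hCT`,
`hW`, `hGZK`, `hmod`; per pair `hr`, `hq`/`hv` (`#Ш_an = 9`), `hSel : Sel^(3)(E/ℚ) ≠ ⊥` — EVIDENCE: the landed
two-engine exact `3`-descent row of `9718c1` in `Supersingular/X8DescentRecords.lean` (`checked_x8_rankZero_sha9_desc3_2`;
`dim_𝔽₃ Sel^(3) = 2` on both engines, same subspace; cert `7e7eba123eac…`; kit j091546). Per pair; OFFER (the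
desk books); class X8 and crux 5 unchanged. [cite: Wuthrich2014, Prop. 21 (p. 400)]
[cite: SilvermanAEC2009, Thm. X.4.14 and VII.1 Remark 1.1] [cite: Miller2011LMS, §1 and Def. 1.1]
[cite: Cremona2006, Table 1 (Cremona label 9718c1)] -/
theorem X8.bsdp3_sel9_9718c1 (hCT : exists_casselsTate_pairing (K := ℚ)) (hW : sha_dvd_analyticSha)
    (hGZK : rank_eq_analyticRank_of_analyticRank_le_one) (hmod : hasEntireLFunction_rat)
    (W : WeierstrassCurve ℚ) (hWm : W = ⟨1, -1, 1, 18, -12407⟩) (hr : W.analyticRank = 0)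
    {q : ℚ} (hq : shaAn W = (q : ℂ)) (hv : padicValRat 3 q ≤ 2) (hSel : W.selmerGroup (3 : ℤ) ≠ ⊥) :
    BSDp W 3 := by
  subst hWm
  exact X8.bsdp_three_rankZero_of_ainvs_of_selmerGroup_ne_bot_of_surj hCT hW hGZK hmod
    1 (-1) 1 18 (-12407)
    (isGloballyMinimal_of_krausCriterion_bounded 1 (-1) 1 18 (-12407)
      (by decide +kernel) (by decide +kernel) (by decide +kernel))
    (by decide) (n₃ := 1) (by decide +kernel) (by decide) surj_x8r0_9718c1_3 hr hq hv hSel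

/-- **`BSD(E,3)` for `9878f1`** — X8 ∩ {r_an = 0} ∩ {surj(3)}, `#Ш_an = 9`; Cremona model `[1,-1,0,-2109631,-1178863891]`,
`N = 9878 = 2·11·449`, good supersingular at `3` with `a₃ = 3`, `ρ̄_{E,3}` onto (`surj_x8r0_9878f1_3`), `#E(ℚ)_tors = 1`,
`∏ c_ℓ = 4`. Kernel-decided: global minimality (the bounded Kraus certificate of `surj_x8r0_9878f1_3`, verbatim), `3 ∤ Δ`, `#Ẽ(𝔽₃) = 1`. Binders: PUBLISHED `hCT`,
`hW`, `hGZK`, `hmod`; per pair `hr`, `hq`/`hv` (`#Ш_an = 9`), `hSel : Sel^(3)(E/ℚ) ≠ ⊥` — EVIDENCE: the landed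
two-engine exact `3`-descent row of `9878f1` in `Supersingular/X8DescentRecords.lean` (`checked_x8_rankZero_sha9_desc3_2`;
`dim_𝔽₃ Sel^(3) = 2` on both engines, same subspace; cert `09b98e02094a…`; kit j091546). Per pair; OFFER (the
desk books); class X8 and crux 5 unchanged. [cite: Wuthrich2014, Prop. 21 (p. 400)]
[cite: SilvermanAEC2009, Thm. X.4.14 and VII.1 Remark 1.1] [cite: Miller2011LMS, §1 and Def. 1.1]
[cite: Cremona2006, Table 1 (Cremona label 9878f1)] -/
theorem X8.bsdp3_sel9_9878f1 (hCT : exists_casselsTate_pairing (K := ℚ)) (hW : sha_dvd_analyticSha)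
    (hGZK : rank_eq_analyticRank_of_analyticRank_le_one) (hmod : hasEntireLFunction_rat)
    (W : WeierstrassCurve ℚ) (hWm : W = ⟨1, -1, 0, -2109631, -1178863891⟩) (hr : W.analyticRank = 0)
    {q : ℚ} (hq : shaAn W = (q : ℂ)) (hv : padicValRat 3 q ≤ 2) (hSel : W.selmerGroup (3 : ℤ) ≠ ⊥) :
    BSDp W 3 := by
  subst hWm
  exact X8.bsdp_three_rankZero_of_ainvs_of_selmerGroup_ne_bot_of_surj hCT hW hGZK hmod
    1 (-1) 0 (-2109631) (-1178863891)
    (isGloballyMinimal_of_krausCriterion_bounded 1 (-1) 0 (-2109631) (-1178863891)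
      (by decide +kernel) (by decide +kernel) (by decide +kernel))
    (by decide) (n₃ := 1) (by decide +kernel) (by decide) surj_x8r0_9878f1_3 hr hq hv hSel

/-- **`BSD(E,3)` for `9950f1`** — X8 ∩ {r_an = 0} ∩ {surj(3)}, `#Ш_an = 9`; Cremona model `[1,-1,0,-787492,-268781584]`,
`N = 9950 = 2·5²·199`, good supersingular at `3` with `a₃ = 3`, `ρ̄_{E,3}` onto (`surj_x8r0_9950f1_3`), `#E(ℚ)_tors = 1`,
`∏ c_ℓ = 6`. Kernel-decided: global minimality (the bounded Kraus certificate of `surj_x8r0_9950f1_3`, verbatim), `3 ∤ Δ`, `#Ẽ(𝔽₃) = 1`. Binders: PUBLISHED `hCT`,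
`hW`, `hGZK`, `hmod`; per pair `hr`, `hq`/`hv` (`#Ш_an = 9`), `hSel : Sel^(3)(E/ℚ) ≠ ⊥` — EVIDENCE: the landed
two-engine exact `3`-descent row of `9950f1` in `Supersingular/X8DescentRecords.lean` (`checked_x8_rankZero_sha9_desc3_2`;
`dim_𝔽₃ Sel^(3) = 2` on both engines, same subspace; cert `0bceac939a44…`; kit j091546). Per pair; OFFER (the
desk books); class X8 and crux 5 unchanged. [cite: Wuthrich2014, Prop. 21 (p. 400)]
[cite: SilvermanAEC2009, Thm. X.4.14 and VII.1 Remark 1.1] [cite: Miller2011LMS, §1 and Def. 1.1]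
[cite: Cremona2006, Table 1 (Cremona label 9950f1)] -/
theorem X8.bsdp3_sel9_9950f1 (hCT : exists_casselsTate_pairing (K := ℚ)) (hW : sha_dvd_analyticSha)
    (hGZK : rank_eq_analyticRank_of_analyticRank_le_one) (hmod : hasEntireLFunction_rat)
    (W : WeierstrassCurve ℚ) (hWm : W = ⟨1, -1, 0, -787492, -268781584⟩) (hr : W.analyticRank = 0)
    {q : ℚ} (hq : shaAn W = (q : ℂ)) (hv : padicValRat 3 q ≤ 2) (hSel : W.selmerGroup (3 : ℤ) ≠ ⊥) :
    BSDp W 3 := by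
  subst hWm
  exact X8.bsdp_three_rankZero_of_ainvs_of_selmerGroup_ne_bot_of_surj hCT hW hGZK hmod
    1 (-1) 0 (-787492) (-268781584)
    (isGloballyMinimal_of_krausCriterion_bounded 1 (-1) 0 (-787492) (-268781584)
      (by decide +kernel) (by decide +kernel) (by decide +kernel))
    (by decide) (n₃ := 1) (by decide +kernel) (by decide) surj_x8r0_9950f1_3 hr hq hv hSel

/-- **`BSD(E,3)` for `10550f1`** — X8 ∩ {r_an = 0} ∩ {surj(3)}, `#Ш_an = 9`; Cremona model `[1,-1,0,-425738542,-3381028995884]`,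
`N = 10550 = 2·5²·211`, good supersingular at `3` with `a₃ = −3`, `ρ̄_{E,3}` onto (`surj_x8r0_10550f1_3`), `#E(ℚ)_tors = 1`,
`∏ c_ℓ = 8`. Kernel-decided: global minimality (the bounded Kraus certificate of `surj_x8r0_10550f1_3`, verbatim), `3 ∤ Δ`, `#Ẽ(𝔽₃) = 7`. Binders: PUBLISHED `hCT`,
`hW`, `hGZK`, `hmod`; per pair `hr`, `hq`/`hv` (`#Ш_an = 9`), `hSel : Sel^(3)(E/ℚ) ≠ ⊥` — EVIDENCE: the landed
two-engine exact `3`-descent row of `10550f1` in `Supersingular/X8DescentRecords.lean` (`checked_x8_rankZero_sha9_desc3_2`;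
`dim_𝔽₃ Sel^(3) = 2` on both engines, same subspace; cert `15ee949417ac…`; kit j091546). Per pair; OFFER (the
desk books); class X8 and crux 5 unchanged. [cite: Wuthrich2014, Prop. 21 (p. 400)]
[cite: SilvermanAEC2009, Thm. X.4.14 and VII.1 Remark 1.1] [cite: Miller2011LMS, §1 and Def. 1.1]
[cite: Cremona2006, Table 1 (Cremona label 10550f1)] -/
theorem X8.bsdp3_sel9_10550f1 (hCT : exists_casselsTate_pairing (K := ℚ)) (hW : sha_dvd_analyticSha)
    (hGZK : rank_eq_analyticRank_of_analyticRank_le_one) (hmod : hasEntireLFunction_rat)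
    (W : WeierstrassCurve ℚ) (hWm : W = ⟨1, -1, 0, -425738542, -3381028995884⟩) (hr : W.analyticRank = 0)
    {q : ℚ} (hq : shaAn W = (q : ℂ)) (hv : padicValRat 3 q ≤ 2) (hSel : W.selmerGroup (3 : ℤ) ≠ ⊥) :
    BSDp W 3 := by
  subst hWm
  exact X8.bsdp_three_rankZero_of_ainvs_of_selmerGroup_ne_bot_of_surj hCT hW hGZK hmod
    1 (-1) 0 (-425738542) (-3381028995884)
    (isGloballyMinimal_of_krausCriterion_bounded 1 (-1) 0 (-425738542) (-3381028995884)
      (by decide +kernel) (by decide +kernel) (by decide +kernel))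
    (by decide) (n₃ := 7) (by decide +kernel) (by decide) surj_x8r0_10550f1_3 hr hq hv hSel

/-- **`BSD(E,3)` for `11075f1`** — X8 ∩ {r_an = 0} ∩ {surj(3)}, `#Ш_an = 9`; Cremona model `[0,0,1,-2575,-50294]`,
`N = 11075 = 5²·443`, good supersingular at `3` with `a₃ = 3`, `ρ̄_{E,3}` onto (`surj_x8r0_11075f1_3`), `#E(ℚ)_tors = 1`,
`∏ c_ℓ = 1`. Kernel-decided: global minimality (the bounded Kraus certificate of `surj_x8r0_11075f1_3`, verbatim), `3 ∤ Δ`, `#Ẽ(𝔽₃) = 1`. Binders: PUBLISHED `hCT`,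
`hW`, `hGZK`, `hmod`; per pair `hr`, `hq`/`hv` (`#Ш_an = 9`), `hSel : Sel^(3)(E/ℚ) ≠ ⊥` — EVIDENCE: the landed
two-engine exact `3`-descent row of `11075f1` in `Supersingular/X8DescentRecords.lean` (`checked_x8_rankZero_sha9_desc3_2`;
`dim_𝔽₃ Sel^(3) = 2` on both engines, same subspace; cert `86dcb805baa7…`; kit j091546). Per pair; OFFER (the
desk books); class X8 and crux 5 unchanged. [cite: Wuthrich2014, Prop. 21 (p. 400)]
[cite: SilvermanAEC2009, Thm. X.4.14 and VII.1 Remark 1.1] [cite: Miller2011LMS, §1 and Def. 1.1]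
[cite: Cremona2006, Table 1 (Cremona label 11075f1)] -/
theorem X8.bsdp3_sel9_11075f1 (hCT : exists_casselsTate_pairing (K := ℚ)) (hW : sha_dvd_analyticSha)
    (hGZK : rank_eq_analyticRank_of_analyticRank_le_one) (hmod : hasEntireLFunction_rat)
    (W : WeierstrassCurve ℚ) (hWm : W = ⟨0, 0, 1, -2575, -50294⟩) (hr : W.analyticRank = 0)
    {q : ℚ} (hq : shaAn W = (q : ℂ)) (hv : padicValRat 3 q ≤ 2) (hSel : W.selmerGroup (3 : ℤ) ≠ ⊥) :
    BSDp W 3 := by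
  subst hWm
  exact X8.bsdp_three_rankZero_of_ainvs_of_selmerGroup_ne_bot_of_surj hCT hW hGZK hmod
    0 0 1 (-2575) (-50294)
    (isGloballyMinimal_of_krausCriterion_bounded 0 0 1 (-2575) (-50294)
      (by decide +kernel) (by decide +kernel) (by decide +kernel))
    (by decide) (n₃ := 1) (by decide +kernel) (by decide) surj_x8r0_11075f1_3 hr hq hv hSel

/-- **`BSD(E,3)` for `11123a1`** — X8 ∩ {r_an = 0} ∩ {surj(3)}, `#Ш_an = 9`; Cremona model `[0,0,1,-343,3001]`,
`N = 11123 = 7²·227`, good supersingular at `3` with `a₃ = 3`, `ρ̄_{E,3}` onto (`surj_x8r0_11123a1_3`), `#E(ℚ)_tors = 1`,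
`∏ c_ℓ = 1` — crux 5's BC5 «first value per pair» cell, hitherto WITHOUT any `BSDp` theorem. Kernel-decided: global minimality (the bounded Kraus certificate of `surj_x8r0_11123a1_3`, verbatim), `3 ∤ Δ`, `#Ẽ(𝔽₃) = 1`. Binders: PUBLISHED `hCT`,
`hW`, `hGZK`, `hmod`; per pair `hr`, `hq`/`hv` (`#Ш_an = 9`), `hSel : Sel^(3)(E/ℚ) ≠ ⊥` — EVIDENCE: the landed
two-engine exact `3`-descent row of `11123a1` in `Supersingular/X8DescentRecords.lean` (`checked_x8_rankZero_sha9_desc3_2`;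
`dim_𝔽₃ Sel^(3) = 2` on both engines, same subspace; cert `3d4164fb85ff…`; kit j091546). Per pair; OFFER (the
desk books); class X8 and crux 5 unchanged. [cite: Wuthrich2014, Prop. 21 (p. 400)]
[cite: SilvermanAEC2009, Thm. X.4.14 and VII.1 Remark 1.1] [cite: Miller2011LMS, §1 and Def. 1.1]
[cite: Cremona2006, Table 1 (Cremona label 11123a1)] -/
theorem X8.bsdp3_sel9_11123a1 (hCT : exists_casselsTate_pairing (K := ℚ)) (hW : sha_dvd_analyticSha)
    (hGZK : rank_eq_analyticRank_of_analyticRank_le_one) (hmod : hasEntireLFunction_rat)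
    (W : WeierstrassCurve ℚ) (hWm : W = ⟨0, 0, 1, -343, 3001⟩) (hr : W.analyticRank = 0)
    {q : ℚ} (hq : shaAn W = (q : ℂ)) (hv : padicValRat 3 q ≤ 2) (hSel : W.selmerGroup (3 : ℤ) ≠ ⊥) :
    BSDp W 3 := by
  subst hWm
  exact X8.bsdp_three_rankZero_of_ainvs_of_selmerGroup_ne_bot_of_surj hCT hW hGZK hmod
    0 0 1 (-343) 3001
    (isGloballyMinimal_of_krausCriterion_bounded 0 0 1 (-343) 3001
      (by decide +kernel) (by decide +kernel) (by decide +kernel))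
    (by decide) (n₃ := 1) (by decide +kernel) (by decide) surj_x8r0_11123a1_3 hr hq hv hSel

/-- **`BSD(E,3)` for `12145b1`** — X8 ∩ {r_an = 0} ∩ {surj(3)}, `#Ш_an = 9`; Cremona model `[0,0,1,317,-24101]`,
`N = 12145 = 5·7·347`, good supersingular at `3` with `a₃ = 3`, `ρ̄_{E,3}` onto (`surj_x8r0_12145b1_3`), `#E(ℚ)_tors = 1`,
`∏ c_ℓ = 2`. Kernel-decided: global minimality (the bounded Kraus certificate of `surj_x8r0_12145b1_3`, verbatim), `3 ∤ Δ`, `#Ẽ(𝔽₃) = 1`. Binders: PUBLISHED `hCT`,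
`hW`, `hGZK`, `hmod`; per pair `hr`, `hq`/`hv` (`#Ш_an = 9`), `hSel : Sel^(3)(E/ℚ) ≠ ⊥` — EVIDENCE: the landed
two-engine exact `3`-descent row of `12145b1` in `Supersingular/X8DescentRecords.lean` (`checked_x8_rankZero_sha9_desc3_2`;
`dim_𝔽₃ Sel^(3) = 2` on both engines, same subspace; cert `b118f779d2de…`; kit j091546). Per pair; OFFER (the
desk books); class X8 and crux 5 unchanged. [cite: Wuthrich2014, Prop. 21 (p. 400)]
[cite: SilvermanAEC2009, Thm. X.4.14 and VII.1 Remark 1.1] [cite: Miller2011LMS, §1 and Def. 1.1]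
[cite: Cremona2006, Table 1 (Cremona label 12145b1)] -/
theorem X8.bsdp3_sel9_12145b1 (hCT : exists_casselsTate_pairing (K := ℚ)) (hW : sha_dvd_analyticSha)
    (hGZK : rank_eq_analyticRank_of_analyticRank_le_one) (hmod : hasEntireLFunction_rat)
    (W : WeierstrassCurve ℚ) (hWm : W = ⟨0, 0, 1, 317, -24101⟩) (hr : W.analyticRank = 0)
    {q : ℚ} (hq : shaAn W = (q : ℂ)) (hv : padicValRat 3 q ≤ 2) (hSel : W.selmerGroup (3 : ℤ) ≠ ⊥) :
    BSDp W 3 := by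
  subst hWm
  exact X8.bsdp_three_rankZero_of_ainvs_of_selmerGroup_ne_bot_of_surj hCT hW hGZK hmod
    0 0 1 317 (-24101)
    (isGloballyMinimal_of_krausCriterion_bounded 0 0 1 317 (-24101)
      (by decide +kernel) (by decide +kernel) (by decide +kernel))
    (by decide) (n₃ := 1) (by decide +kernel) (by decide) surj_x8r0_12145b1_3 hr hq hv hSel

/-- **`BSD(E,3)` for `12155c1`** — X8 ∩ {r_an = 0} ∩ {surj(3)}, `#Ш_an = 9`; Cremona model `[1,-1,0,-11230,-455389]`,
`N = 12155 = 5·11·13·17`, good supersingular at `3` with `a₃ = 3`, `ρ̄_{E,3}` onto (`surj_x8r0_12155c1_3`), `#E(ℚ)_tors = 1`,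
`∏ c_ℓ = 3`. Kernel-decided: global minimality (the bounded Kraus certificate of `surj_x8r0_12155c1_3`, verbatim), `3 ∤ Δ`, `#Ẽ(𝔽₃) = 1`. Binders: PUBLISHED `hCT`,
`hW`, `hGZK`, `hmod`; per pair `hr`, `hq`/`hv` (`#Ш_an = 9`), `hSel : Sel^(3)(E/ℚ) ≠ ⊥` — EVIDENCE: the landed
two-engine exact `3`-descent row of `12155c1` in `Supersingular/X8DescentRecords.lean` (`checked_x8_rankZero_sha9_desc3_2`;
`dim_𝔽₃ Sel^(3) = 2` on both engines, same subspace; cert `042984af944f…`; kit j091546). Per pair; OFFER (the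
desk books); class X8 and crux 5 unchanged. [cite: Wuthrich2014, Prop. 21 (p. 400)]
[cite: SilvermanAEC2009, Thm. X.4.14 and VII.1 Remark 1.1] [cite: Miller2011LMS, §1 and Def. 1.1]
[cite: Cremona2006, Table 1 (Cremona label 12155c1)] -/
theorem X8.bsdp3_sel9_12155c1 (hCT : exists_casselsTate_pairing (K := ℚ)) (hW : sha_dvd_analyticSha)
    (hGZK : rank_eq_analyticRank_of_analyticRank_le_one) (hmod : hasEntireLFunction_rat)
    (W : WeierstrassCurve ℚ) (hWm : W = ⟨1, -1, 0, -11230, -455389⟩) (hr : W.analyticRank = 0)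
    {q : ℚ} (hq : shaAn W = (q : ℂ)) (hv : padicValRat 3 q ≤ 2) (hSel : W.selmerGroup (3 : ℤ) ≠ ⊥) :
    BSDp W 3 := by
  subst hWm
  exact X8.bsdp_three_rankZero_of_ainvs_of_selmerGroup_ne_bot_of_surj hCT hW hGZK hmod
    1 (-1) 0 (-11230) (-455389)
    (isGloballyMinimal_of_krausCriterion_bounded 1 (-1) 0 (-11230) (-455389)
      (by decide +kernel) (by decide +kernel) (by decide +kernel))
    (by decide) (n₃ := 1) (by decide +kernel) (by decide) surj_x8r0_12155c1_3 hr hq hv hSel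

/-- **`BSD(E,3)` for `12584l1`** — X8 ∩ {r_an = 0} ∩ {surj(3)}, `#Ш_an = 9`; Cremona model `[0,0,0,3509,-82522]`,
`N = 12584 = 2³·11²·13`, good supersingular at `3` with `a₃ = 3`, `ρ̄_{E,3}` onto (`surj_x8r0_12584l1_3`), `#E(ℚ)_tors = 1`,
`∏ c_ℓ = 2`. Kernel-decided: global minimality (the bounded Kraus certificate of `surj_x8r0_12584l1_3`, verbatim), `3 ∤ Δ`, `#Ẽ(𝔽₃) = 1`. Binders: PUBLISHED `hCT`,
`hW`, `hGZK`, `hmod`; per pair `hr`, `hq`/`hv` (`#Ш_an = 9`), `hSel : Sel^(3)(E/ℚ) ≠ ⊥` — EVIDENCE: the landed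
two-engine exact `3`-descent row of `12584l1` in `Supersingular/X8DescentRecords.lean` (`checked_x8_rankZero_sha9_desc3_2`;
`dim_𝔽₃ Sel^(3) = 2` on both engines, same subspace; cert `d0740158bb22…`; kit j091546). Per pair; OFFER (the
desk books); class X8 and crux 5 unchanged. [cite: Wuthrich2014, Prop. 21 (p. 400)]
[cite: SilvermanAEC2009, Thm. X.4.14 and VII.1 Remark 1.1] [cite: Miller2011LMS, §1 and Def. 1.1]
[cite: Cremona2006, Table 1 (Cremona label 12584l1)] -/
theorem X8.bsdp3_sel9_12584l1 (hCT : exists_casselsTate_pairing (K := ℚ)) (hW : sha_dvd_analyticSha)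
    (hGZK : rank_eq_analyticRank_of_analyticRank_le_one) (hmod : hasEntireLFunction_rat)
    (W : WeierstrassCurve ℚ) (hWm : W = ⟨0, 0, 0, 3509, -82522⟩) (hr : W.analyticRank = 0)
    {q : ℚ} (hq : shaAn W = (q : ℂ)) (hv : padicValRat 3 q ≤ 2) (hSel : W.selmerGroup (3 : ℤ) ≠ ⊥) :
    BSDp W 3 := by
  subst hWm
  exact X8.bsdp_three_rankZero_of_ainvs_of_selmerGroup_ne_bot_of_surj hCT hW hGZK hmod
    0 0 0 3509 (-82522)
    (isGloballyMinimal_of_krausCriterion_bounded 0 0 0 3509 (-82522)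
      (by decide +kernel) (by decide +kernel) (by decide +kernel))
    (by decide) (n₃ := 1) (by decide +kernel) (by decide) surj_x8r0_12584l1_3 hr hq hv hSel

/-- **`BSD(E,3)` for `13736e1`** — X8 ∩ {r_an = 0} ∩ {surj(3)}, `#Ш_an = 9`; Cremona model `[0,0,0,-811,-8890]`,
`N = 13736 = 2³·17·101`, good supersingular at `3` with `a₃ = 3`, `ρ̄_{E,3}` onto (`surj_x8r0_13736e1_3`), `#E(ℚ)_tors = 1`,
`∏ c_ℓ = 1`. Kernel-decided: global minimality (the bounded Kraus certificate of `surj_x8r0_13736e1_3`, verbatim), `3 ∤ Δ`, `#Ẽ(𝔽₃) = 1`. Binders: PUBLISHED `hCT`,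
`hW`, `hGZK`, `hmod`; per pair `hr`, `hq`/`hv` (`#Ш_an = 9`), `hSel : Sel^(3)(E/ℚ) ≠ ⊥` — EVIDENCE: the landed
two-engine exact `3`-descent row of `13736e1` in `Supersingular/X8DescentRecords.lean` (`checked_x8_rankZero_sha9_desc3_3`;
`dim_𝔽₃ Sel^(3) = 2` on both engines, same subspace; cert `d553643b9448…`; kit j091546). Per pair; OFFER (the
desk books); class X8 and crux 5 unchanged. [cite: Wuthrich2014, Prop. 21 (p. 400)]
[cite: SilvermanAEC2009, Thm. X.4.14 and VII.1 Remark 1.1] [cite: Miller2011LMS, §1 and Def. 1.1]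
[cite: Cremona2006, Table 1 (Cremona label 13736e1)] -/
theorem X8.bsdp3_sel9_13736e1 (hCT : exists_casselsTate_pairing (K := ℚ)) (hW : sha_dvd_analyticSha)
    (hGZK : rank_eq_analyticRank_of_analyticRank_le_one) (hmod : hasEntireLFunction_rat)
    (W : WeierstrassCurve ℚ) (hWm : W = ⟨0, 0, 0, -811, -8890⟩) (hr : W.analyticRank = 0)
    {q : ℚ} (hq : shaAn W = (q : ℂ)) (hv : padicValRat 3 q ≤ 2) (hSel : W.selmerGroup (3 : ℤ) ≠ ⊥) :
    BSDp W 3 := by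
  subst hWm
  exact X8.bsdp_three_rankZero_of_ainvs_of_selmerGroup_ne_bot_of_surj hCT hW hGZK hmod
    0 0 0 (-811) (-8890)
    (isGloballyMinimal_of_krausCriterion_bounded 0 0 0 (-811) (-8890)
      (by decide +kernel) (by decide +kernel) (by decide +kernel))
    (by decide) (n₃ := 1) (by decide +kernel) (by decide) surj_x8r0_13736e1_3 hr hq hv hSel

end Summit.BirchSwinnertonDyer.BirchSwinnertonDyer.Theorems

end
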